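import Summits.NavierStokesRegularity.TurbBounds.FSU1.Check

/-!
# FS-U1″ finite part in Lean — soundness of the cell criterion and cover bookkeeping (§4–§5)
(split by topic from `FSU1/Check.lean` at the gen-20 re-stage, LEAD decision 118 (A); same producer / staging / proof of record as `FSU1/Check.lean`.)

HONEST FRAMING: rigorous bounds for the stated PDE and boundary conditions; no claim about physical turbulence beyond the bound.

CONTENTS. §4 the MASTER LEMMA `cellIneq_of_check : cellCheck p r = true → CellIneq p r.κa r.κb r.ε` (and its list form `cellIneq_of_all`);
§5 cover bookkeeping (`lastKb`, `chainOK`, `coverCheck` and `cover_of_check`: every `κ ∈ [0, κ_I]` lies in a listed cell).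
-/

set_option linter.style.longLine false
set_option autoImplicit false

namespace Summit.NavierStokesRegularity.TurbBounds.FSU1

/-! ## 4. The master lemma: the rational criterion implies (A_cell) over `ℝ` -/

/-- MASTER LEMMA: the rational criterion `cellCheck p r = true` implies the real cell inequality (A_cell) `CellIneq p r.κa r.κb r.ε`. -/
theorem cellIneq_of_check (p : Params) (r : Row) (h : cellCheck p r = true) : CellIneq p r.ka r.kb r.eps := by
  -- unpack the Boolean certificate
  have hb : checkBasic p r = true := by simp only [cellCheck, Bool.and_eq_true] at h; exact h.1.1.1.1.1
  have hphi : checkPhi p r = true := by simp only [cellCheck, Bool.and_eq_true] at h; exact h.1.1.1.1.2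
  have hm : checkM p r = true := by simp only [cellCheck, Bool.and_eq_true] at h; exact h.1.1.1.2
  have hpq : checkPQ p r = true := by simp only [cellCheck, Bool.and_eq_true] at h; exact h.1.1.2
  have hexp : checkExp r = true := by simp only [cellCheck, Bool.and_eq_true] at h; exact h.1.2
  have hfin : checkFinal p r = true := by simp only [cellCheck, Bool.and_eq_true] at h; exact h.2
  simp only [checkBasic, Bool.and_eq_true, decide_eq_true_eq] at hb
  obtain ⟨⟨⟨⟨⟨⟨⟨ha, hbp⟩, hD⟩, hka⟩, hkab⟩, hkbI⟩, heps0⟩, heps1⟩ := hb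
  simp only [checkM, Bool.and_eq_true, decide_eq_true_eq] at hm
  obtain ⟨hmw1, hmw2⟩ := hm
  simp only [checkPQ, Bool.and_eq_true, decide_eq_true_eq] at hpq
  obtain ⟨⟨⟨hsP0, hsP2⟩, hsQ1⟩, hsQ2⟩ := hpq
  simp only [checkExp, Bool.and_eq_true, decide_eq_true_eq] at hexp
  obtain ⟨⟨⟨⟨⟨⟨hEK0, hEK⟩, hEQ0⟩, hEQ⟩, hSH0⟩, hS1⟩, hSH⟩ := hexp
  simp only [checkFinal, Bool.and_eq_true, decide_eq_true_eq] at hfin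
  obtain ⟨⟨hPH0, hPJ0⟩, hfinal⟩ := hfin
  -- real casts of the basic facts
  have haR : (0 : ℝ) < (p.a : ℝ) := by exact_mod_cast ha
  have hcQ : 0 < p.c := by unfold Params.c; exact div_pos hbp ha
  have hcR : (0 : ℝ) < (p.c : ℝ) := by exact_mod_cast hcQ
  have hkbQ : 0 < r.kb := lt_of_le_of_lt hka hkab
  have hkbR : (0 : ℝ) < (r.kb : ℝ) := by exact_mod_cast hkbQ
  have hkaR : (0 : ℝ) ≤ (r.ka : ℝ) := by exact_mod_cast hka
  -- (1) inf Φ ≥ phiLower > 0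
  have hPhi : ((phiLower p r : ℚ) : ℝ) ≤ PhiInf p r.ka r.kb := by
    unfold phiLower PhiInf
    unfold checkPhi at hphi
    split_ifs at hphi ⊢ with h1 h2
    · simp only [Bool.and_eq_true, decide_eq_true_eq] at hphi
      obtain ⟨⟨hs0, _⟩, hs2⟩ := hphi
      push_cast
      exact Phi_ge haR.le hkbR (by exact_mod_cast hs0) (by exact_mod_cast hs2)
    · simp only [Bool.and_eq_true, decide_eq_true_eq] at hphi
      obtain ⟨⟨hs0, _⟩, hs2, hka0⟩ := hphi
      push_cast
      exact Phi_ge haR.le (by exact_mod_cast hka0) (by exact_mod_cast hs0) (by exact_mod_cast hs2)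
    · simp only [Bool.and_eq_true, decide_eq_true_eq] at hphi
      obtain ⟨⟨hs0, _⟩, hs2⟩ := hphi
      push_cast
      have hbpR : (0 : ℝ) ≤ (p.bp : ℝ) := by exact_mod_cast hbp.le
      have h0 : (0 : ℝ) ≤ ((r.sPhi : ℚ) : ℝ) := by exact_mod_cast hs0
      have h2 : ((r.sPhi : ℚ) : ℝ) ^ 2 ≤ 3 * (p.a : ℝ) * p.bp := by exact_mod_cast hs2
      have : ((r.sPhi : ℚ) : ℝ) ≤ Real.sqrt (3 * (p.a : ℝ) * p.bp) := (Real.sqrt_sq h0).symm.trans_le (Real.sqrt_le_sqrt h2)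
      linarith
  have hPhiLpos : (0 : ℝ) < ((phiLower p r : ℚ) : ℝ) := by
    have : 0 < phiLower p r := by
      unfold checkPhi at hphi
      simp only [Bool.and_eq_true, decide_eq_true_eq] at hphi
      split_ifs at hphi <;> exact hphi.1.2
    exact_mod_cast this
  have hPhiInfpos : 0 < PhiInf p r.ka r.kb := lt_of_lt_of_le hPhiLpos hPhi
  -- (2) m̃_b ≥ mw > 1
  have hmwR : (1 : ℝ) < (r.mw : ℝ) := by exact_mod_cast hmw1
  have hM : ((r.mw : ℚ) : ℝ) ≤ mt p r.kb := by
    unfold mt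
    have h0 : (0 : ℝ) ≤ ((r.mw : ℚ) : ℝ) := by linarith
    refine (Real.sqrt_sq h0).symm.trans_le (Real.sqrt_le_sqrt ?_)
    have hk2 : (0 : ℝ) < (r.kb : ℝ) ^ 2 := by positivity
    rw [show (1 : ℝ) + (p.c : ℝ) / (r.kb : ℝ) ^ 2 = ((r.kb : ℝ) ^ 2 + p.c) / (r.kb : ℝ) ^ 2 by field_simp]
    rw [le_div_iff₀ hk2]
    exact_mod_cast hmw2
  have hM1 : 1 < mt p r.kb := lt_of_lt_of_le hmwR hM
  set M : ℝ := mt p r.kb with hMdef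
  have hratio : (M + 1) / (M - 1) ≤ ((r.mw : ℝ) + 1) / ((r.mw : ℝ) - 1) := by
    rw [div_le_div_iff₀ (by linarith) (by linarith)]; nlinarith
  have hinvM : ∀ {t : ℝ}, 0 ≤ t → t / (M - 1) ≤ t / ((r.mw : ℝ) - 1) := fun ht =>
    div_le_div_of_nonneg_left ht (by linarith) (by linarith)
  -- (3) P and Q
  have hsP0R : (0 : ℝ) ≤ ((r.sP : ℚ) : ℝ) := by exact_mod_cast hsP0
  have hsP2R : ((r.sP : ℚ) : ℝ) ^ 2 ≤ (r.ka : ℝ) ^ 2 + p.c := by exact_mod_cast hsP2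
  have hsqrtP : ((r.sP : ℚ) : ℝ) ≤ Real.sqrt ((r.ka : ℝ) ^ 2 + p.c) := (Real.sqrt_sq hsP0R).symm.trans_le (Real.sqrt_le_sqrt hsP2R)
  have hsQ0 : (0 : ℝ) ≤ ((r.sQ : ℚ) : ℝ) := by
    have h' : ((r.kb : ℚ) : ℝ) ≤ r.sQ := by exact_mod_cast hsQ1
    linarith
  have hsQ2R : ((r.sQ : ℚ) : ℝ) ^ 2 ≤ (r.kb : ℝ) ^ 2 + p.c := by exact_mod_cast hsQ2
  have hsqrtQ : ((r.sQ : ℚ) : ℝ) ≤ Real.sqrt ((r.kb : ℝ) ^ 2 + p.c) := (Real.sqrt_sq hsQ0).symm.trans_le (Real.sqrt_le_sqrt hsQ2R)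
  have hPw_le : ((Pw r : ℚ) : ℝ) ≤ Pfn p r.ka := by
    unfold Pw Pfn
    push_cast
    refine le_trans (min_le_left _ _) ?_
    have hsum : ((r.sP : ℝ) + r.ka) ≤ Real.sqrt ((r.ka : ℝ) ^ 2 + p.c) + r.ka := by linarith
    have hsum0 : (0 : ℝ) ≤ (r.sP : ℝ) + r.ka := by
      have : (0:ℝ) ≤ (r.sP : ℝ) := by exact_mod_cast hsP0
      linarith
    have := mul_le_mul R4LO_le_R4 hsum hsum0 (by unfold R4; positivity)
    linarith
  have hPw0 : 0 ≤ Pw r := by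
    unfold Pw
    refine le_min ?_ (by norm_num [PWCAP])
    have : 0 ≤ R4LO := by norm_num [R4LO]
    have : 0 ≤ r.sP + r.ka := by linarith
    positivity
  have hQw_le : ((Qw r : ℚ) : ℝ) ≤ Qfn p r.kb := by
    unfold Qw Qfn
    push_cast
    have hdiff : ((r.sQ : ℝ) - r.kb) ≤ Real.sqrt ((r.kb : ℝ) ^ 2 + p.c) - r.kb := by linarith
    have hdiff0 : (0 : ℝ) ≤ (r.sQ : ℝ) - r.kb := by
      have h' : ((r.kb:ℚ):ℝ) ≤ r.sQ := by exact_mod_cast hsQ1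
      linarith
    have := mul_le_mul R4LO_le_R4 hdiff hdiff0 (by unfold R4; positivity)
    linarith
  have hQw0 : 0 ≤ Qw r := by
    unfold Qw
    have : 0 ≤ R4LO := by norm_num [R4LO]
    have : 0 ≤ r.sQ - r.kb := by linarith
    positivity
  -- (4) ε̄₁ ≤ e1w
  have hexpQ : Real.exp (-Qfn p r.kb) ≤ (r.EQ : ℝ) := exp_neg_le_of_wit hQw0 hQw_le hEQ0 hEQ
  have hsinhP : ((r.SH : ℚ) : ℝ) ≤ Real.sinh (Pfn p r.ka) := sinh_ge_of_wit hPw0 hPw_le hS1 hSH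
  have hSHR : (0 : ℝ) < (r.SH : ℝ) := by exact_mod_cast hSH0
  have hsinhpos : 0 < Real.sinh (Pfn p r.ka) := lt_of_lt_of_le hSHR hsinhP
  have hEQR : (0 : ℝ) ≤ (r.EQ : ℝ) := by exact_mod_cast hEQ0
  have hE1 : eps1bar p r.ka r.kb ≤ ((e1w r : ℚ) : ℝ) := by
    unfold eps1bar e1w
    push_cast
    calc 2 * Real.exp (-Qfn p r.kb) / Real.sinh (Pfn p r.ka)
        ≤ 2 * (r.EQ : ℝ) / Real.sinh (Pfn p r.ka) :=
          div_le_div_of_nonneg_right (by linarith) hsinhpos.le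
      _ ≤ 2 * (r.EQ : ℝ) / (r.SH : ℝ) := div_le_div_of_nonneg_left (by positivity) hSHR hsinhP
  have hE1_nonneg : 0 ≤ eps1bar p r.ka r.kb := by
    unfold eps1bar; exact div_nonneg (by positivity) hsinhpos.le
  have he1w_nonneg : (0 : ℝ) ≤ ((e1w r : ℚ) : ℝ) := le_trans hE1_nonneg hE1
  -- (5) Ḡ(κa·Ra₀^{1/4}) ≤ Gw
  have hkw_le : ((kw r : ℚ) : ℝ) ≤ (r.ka : ℝ) * R4 := by
    unfold kw; push_cast; exact mul_le_mul_of_nonneg_left R4LO_le_R4 hkaR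
  have hEKR : (0 : ℝ) ≤ (r.EK : ℝ) := by exact_mod_cast hEK0
  have hG : Gbar ((r.ka : ℝ) * R4) ≤ ((Gw r : ℚ) : ℝ) := by
    refine le_trans (Gbar_antitone hkw_le) ?_
    unfold Gbar Gw
    by_cases h2 : 2 ≤ kw r
    · have h2R : (2 : ℝ) ≤ ((kw r : ℚ) : ℝ) := by exact_mod_cast h2
      rw [if_pos h2R, if_pos h2]
      push_cast
      have hkw2 : kw2 r = kw r := by unfold kw2; exact max_eq_left h2
      have hex : Real.exp (-(((kw r : ℚ) : ℝ))) ≤ (r.EK : ℝ) :=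
        exp_neg_le_of_wit (by linarith) (le_refl _) hEK0 (by rw [← hkw2]; exact hEK)
      have hk1 : (0 : ℝ) ≤ ((kw r : ℚ) : ℝ) - 1 := by linarith
      nlinarith [mul_le_mul_of_nonneg_right hex hk1]
    · have h2R : ¬ (2 : ℝ) ≤ ((kw r : ℚ) : ℝ) := fun hh => h2 (by exact_mod_cast hh)
      rw [if_neg h2R, if_neg h2]
      push_cast
      have hkw2 : kw2 r = 2 := by unfold kw2; exact max_eq_right (le_of_lt (not_le.mp h2))
      have hex : Real.exp (-(2 : ℝ)) ≤ (r.EK : ℝ) := by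
        have := exp_neg_le_of_wit (x := 2) (y := (2:ℝ)) (E := r.EK) (by norm_num) (by norm_num) hEK0 (by rw [← hkw2]; exact hEK)
        simpa using this
      linarith
  have hGw_nonneg : (0 : ℝ) ≤ ((Gw r : ℚ) : ℝ) := le_trans (Gbar_nonneg _) hG
  -- (6) F_cell ≥ Fw > 0
  have hX_le : Gbar ((r.ka : ℝ) * R4) * ((M + 1) / (M - 1)) + 2 * eps1bar p r.ka r.kb / (M - 1)
      ≤ ((Gw r : ℚ) : ℝ) * (((r.mw : ℝ) + 1) / ((r.mw : ℝ) - 1)) + 2 * ((e1w r : ℚ) : ℝ) / ((r.mw : ℝ) - 1) := by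
    have hr0 : 0 ≤ (M + 1) / (M - 1) := div_nonneg (by linarith) (by linarith)
    have t1 := mul_le_mul hG hratio hr0 hGw_nonneg
    have t2 : 2 * eps1bar p r.ka r.kb / (M - 1) ≤ 2 * ((e1w r : ℚ) : ℝ) / ((r.mw : ℝ) - 1) :=
      le_trans (div_le_div_of_nonneg_right (by linarith) (by linarith)) (hinvM (by linarith))
    linarith
  have hX_nonneg : 0 ≤ Gbar ((r.ka : ℝ) * R4) * ((M + 1) / (M - 1)) + 2 * eps1bar p r.ka r.kb / (M - 1) := by
    have hr0 : 0 ≤ (M + 1) / (M - 1) := div_nonneg (by linarith) (by linarith)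
    have := Gbar_nonneg ((r.ka : ℝ) * R4)
    have : 0 ≤ 2 * eps1bar p r.ka r.kb / (M - 1) := div_nonneg (by linarith) (by linarith)
    positivity
  have hFw_cast : ((Fw r : ℚ) : ℝ) = 1 / (1 + ((Gw r : ℚ) : ℝ) * (((r.mw : ℝ) + 1) / ((r.mw : ℝ) - 1)) + 2 * ((e1w r : ℚ) : ℝ) / ((r.mw : ℝ) - 1)) := by
    unfold Fw; push_cast; ring
  have hF : ((Fw r : ℚ) : ℝ) ≤ Fcell p r.ka r.kb := by
    rw [hFw_cast]; unfold Fcell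
    exact one_div_le_one_div_of_le (by linarith) (by linarith)
  have hFw_pos : (0 : ℝ) < ((Fw r : ℚ) : ℝ) := by
    rw [hFw_cast]
    have hr0 : (0:ℝ) ≤ ((r.mw : ℝ) + 1) / ((r.mw : ℝ) - 1) := div_nonneg (by linarith) (by linarith)
    have : (0:ℝ) ≤ 2 * ((e1w r : ℚ) : ℝ) / ((r.mw : ℝ) - 1) := div_nonneg (by linarith) (by linarith)
    positivity
  have hFpos : 0 < Fcell p r.ka r.kb := lt_of_lt_of_le hFw_pos hF
  -- (7) r̄₁² ≤ R1, r̄₂² ≤ R2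
  have hR1 : r1sq p r.ka r.kb ≤ ((R1 p r : ℚ) : ℝ) := by
    unfold r1sq R1 PH
    rw [evenPoly_cast]
    push_cast
    have hN : (0 : ℝ) ≤ 1 / 4 * (p.D : ℝ) ^ 3 * ((evenPolyQ PHc (rhoB p r.kb) : ℚ) : ℝ) := by
      have : (0:ℝ) ≤ ((evenPolyQ PHc (rhoB p r.kb) : ℚ) : ℝ) := by exact_mod_cast hPH0
      have : (0:ℝ) < (p.D : ℝ) := by exact_mod_cast hD
      positivity
    exact div_le_div_of_nonneg_left hN (mul_pos hFw_pos hPhiLpos) (mul_le_mul hF hPhi hPhiLpos.le hFpos.le)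
  have hR2 := r2sq_le_R2q p r.kb (rhoB p r.kb) ha hbp hD hPJ0
  -- (8) conclude
  have heps0R : (0 : ℝ) < (r.eps : ℝ) := by exact_mod_cast heps0
  have heps1R : (r.eps : ℝ) < 1 := by exact_mod_cast heps1
  have hfinR : ((R1 p r : ℚ) : ℝ) / (1 - (r.eps : ℝ)) + ((R2q p r.kb (rhoB p r.kb) : ℚ) : ℝ) / (r.eps : ℝ) ≤ 1 := by
    have := hfinal
    have h' : (((R1 p r / (1 - r.eps) + R2q p r.kb (rhoB p r.kb) / r.eps : ℚ)) : ℝ) ≤ 1 := by exact_mod_cast this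
    push_cast at h'
    exact h'
  refine ⟨hka, hkab, hkbI, heps0, heps1, hM1, hPhiInfpos, hFpos, ?_⟩
  calc r1sq p r.ka r.kb / (1 - (r.eps : ℝ)) + r2sq p r.kb (rhoB p r.kb) / (r.eps : ℝ)
      ≤ ((R1 p r : ℚ) : ℝ) / (1 - (r.eps : ℝ)) + ((R2q p r.kb (rhoB p r.kb) : ℚ) : ℝ) / (r.eps : ℝ) :=
        add_le_add (div_le_div_of_nonneg_right hR1 (by linarith)) (div_le_div_of_nonneg_right hR2 heps0R.le)
    _ ≤ 1 := hfinR

/-- List form of the master lemma: if every row of `l` passes `cellCheck p`, every listed cell satisfies (A_cell). -/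
theorem cellIneq_of_all {p : Params} {l : List Row} (h : l.all (cellCheck p) = true) :
    ∀ r ∈ l, CellIneq p r.ka r.kb r.eps :=
  fun r hr => cellIneq_of_check p r (List.all_eq_true.mp h r hr)


/-! ## 5. Cover bookkeeping: consecutive cells with common endpoints cover `[0, κ_I]` -/

/-- `κb` of the last cell of the chain `r, t`. -/
def lastKb : Row → List Row → ℚ
  | r, [] => r.kb
  | _, s :: t => lastKb s t
/-- Consecutive cells share their endpoints. -/
def chainOK : Row → List Row → Bool
  | _, [] => true
  | r, s :: t => decide (r.kb = s.ka) && chainOK s t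
/-- The list of cells covers `[0, κ_I]`: the first `κa` is `0`, consecutive endpoints agree, the last `κb` is `κ_I`. -/
def coverCheck (p : Params) : List Row → Bool
  | [] => false
  | r :: t => decide (r.ka = 0) && decide (lastKb r t = p.kapI) && chainOK r t

/-- A chain of cells with matching consecutive endpoints covers `[κa(first), κb(last)]`. -/
theorem cover_of_chain : ∀ (t : List Row) (r : Row), chainOK r t = true →
    ∀ κ : ℝ, (r.ka : ℝ) ≤ κ → κ ≤ ((lastKb r t : ℚ) : ℝ) → ∃ s ∈ r :: t, (s.ka : ℝ) ≤ κ ∧ κ ≤ (s.kb : ℝ)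
  | [], r, _, κ, h1, h2 => ⟨r, by simp, h1, by simpa [lastKb] using h2⟩
  | s :: t, r, hc, κ, h1, h2 => by
      by_cases hk : κ ≤ (r.kb : ℝ)
      · exact ⟨r, by simp, h1, hk⟩
      · have hc' : r.kb = s.ka ∧ chainOK s t = true := by simpa [chainOK] using hc
        have h1' : (s.ka : ℝ) ≤ κ := by rw [← hc'.1]; exact (not_le.mp hk).le
        have h2' : κ ≤ ((lastKb s t : ℚ) : ℝ) := by simpa [lastKb] using h2
        obtain ⟨u, hu, h⟩ := cover_of_chain t s hc'.2 κ h1' h2'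
        exact ⟨u, List.mem_cons_of_mem _ hu, h⟩

/-- `coverCheck p l = true` implies that every `κ ∈ [0, κ_I]` lies in some listed cell `[κa, κb]`. -/
theorem cover_of_check {p : Params} {l : List Row} (h : coverCheck p l = true) :
    ∀ κ : ℝ, 0 ≤ κ → κ ≤ (p.kapI : ℝ) → ∃ s ∈ l, (s.ka : ℝ) ≤ κ ∧ κ ≤ (s.kb : ℝ) := by
  match l, h with
  | [], h => simp [coverCheck] at h
  | r :: t, h =>
    have h' : (r.ka = 0 ∧ lastKb r t = p.kapI) ∧ chainOK r t = true := by
      simpa [coverCheck, Bool.and_eq_true, decide_eq_true_eq] using h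
    intro κ h0 hI
    refine cover_of_chain t r h'.2 κ ?_ ?_
    · rw [h'.1.1]; push_cast; exact h0
    · rw [h'.1.2]; exact hI


end Summit.NavierStokesRegularity.TurbBounds.FSU1
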